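import Summits.RiemannHypothesis.RiemannHypothesis.Theorems.Splittings.RobinFiniteHighCoverCert
import Summits.RiemannHypothesis.RiemannHypothesis.Theorems.Splittings.RobinFiniteSqrtWindowRefl
import HarnessLib

/-!
# RobinFiniteHighCoverLaw — g18 add-on «HIGH COVERS» (part 4/6)

`mertensProdLt_levelH` (one high level), `mertensProdLt_highH` (dispatch `18 … 31`, top partial), THE HIGH LAW `robinCA_below_highH` ({Büthe 2018, BKLNW} + `RH(T)` + base `robinCA_below (4¹⁸)` + level conditions ⟹ `robinCA_below (X+1)`, `X ≤ 10¹⁹`), tolerances `tolHi`, `levelH_of_tol`, and the full-level range theorem `robinCA_below_cellsH` (base discharged by lane (ix-k)'s `robinCA_below_of_rh1320000SR`).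

Cell rh-split, seat rh-split-robin-finite g18 (brief sha16 f79c5f09d8bcb036), card `cards/SPLIT-robin-finite.md` §25 (block §25.14); carved VERBATIM from the
kernel-checked object `HOME/rh-split-robin-finite/g18/hi/SketchHi.lean` (sha16 0a7e1de567237bc8; `lean check` rc 0, 0 warnings, 0 sorries).  Zero `instance`, zero
`notation`, no attribute changes, no `native_decide`; no `def … : Prop`; every print fact appears only as an explicit hypothesis (`Buthe2018_thm2_theta`,
`BroadbentEtAl2021_theta_rel_1e19`, `RiemannHypothesisUpTo T`) — Büthe 2016 is NOT used anywhere in this add-on.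

THE LINE (add-on «HIGH COVERS»).  The tree's `√`-window cell certificates stop at level `k = 17` (`P < 4¹⁸`) only because gens 11–16 aimed at
`T ≤ 3·10⁶`; above `4¹⁸` every law in the tree prices the CA Mertens step with the ANALYTIC ramp budgets `κ = 0.0773 / 0.0904` (lane (ix-c)), an
order of magnitude below what cells give.  `cover_keyS` is generic in the level: this add-on supplies NEW covers for `18 ≤ k ≤ 31` (`4¹⁸ ≤ P ≤ 10¹⁹`,
the end of Büthe's boxes) — maximal cells on the 5-smooth anchor grid, 25–34 cells per level, budgets `b″_k = 0.608 … 0.709`, each `decide +kernel`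
and tight to `10⁻³` — the key inequality `key_ineq_levelH`, the level law `robinCA_below_highH` (base `robinCA_below (4¹⁸)` from lane (ix-k)), and rows:
`RH(2.22·10⁶) ⟹ CA primes < 4¹⁹`, …, `RH(1.22·10¹⁰) ⟹ < 4³¹`, `RH(1.82·10¹⁰) ⟹ ≤ 10¹⁹`; at the van de Lune–te Riele–Winter height `5.45·10⁸`:
Robin ∀ `5040 < n ≤ 10^(19·10¹⁴)` (tree `10^(14·10¹²)`), at Platt's rigorous `3.06·10¹⁰`: ∀ `5040 < n ≤ 10^(43·10¹⁷)` (tree `10^(4·10¹⁶)`).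

HONEST LABEL: «SPLITTING SEARCH over kernel-typed RH-EQUIVALENCES; a splitting A ∧ B ⟹ RH is CONDITIONAL bookkeeping unless A and B
are both proved; nothing here bears on the truth of RH.»
-/

set_option linter.dupNamespace false

noncomputable section

open Real Filter Finset
open scoped Chebyshev

namespace Summit.RiemannHypothesis.RiemannHypothesis.Theorems.Splittings.RobinFiniteC1

open Literature.NumberTheory.LFunctions Literature.NumberTheory.DiophantineGeometry
open RobinAnalyticSharp RobinAnalyticSharp.Cells
open Summit.RiemannHypothesis.RiemannHypothesis.Theorems.Splittings.RobinFiniteE3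

section HighLaw

open Summit.RiemannHypothesis.RiemannHypothesis.Theorems.Splittings.RobinFiniteTail

/-! ### HD · the CA Mertens / Robin law on `4¹⁸ ≤ P ≤ X ≤ 10¹⁹` (levels 18–31 by the high covers; `P < 4¹⁸` by hypothesis) -/

/-- `a + 1/a` is monotone on `[1, ∞)` (file-local copy of the private tree lemma `RobinFiniteSqrtWindowRefl.add_inv_mono_one`). -/
private theorem add_inv_mono_hi {a b : ℝ} (ha : 1 ≤ a) (hab : a ≤ b) : a + a⁻¹ ≤ b + b⁻¹ := by
  have ha0 : 0 < a := by linarith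
  have hb0 : 0 < b := by linarith
  rw [← sub_nonneg]
  have e : b + b⁻¹ - (a + a⁻¹) = (b - a) * (1 - 1 / (a * b)) := by
    field_simp
    ring
  rw [e]
  refine mul_nonneg (by linarith) ?_
  rw [sub_nonneg, div_le_one (mul_pos ha0 hb0)]
  nlinarith

/-- **CA Mertens at a high level `18 ≤ k ≤ 31`**: at any `T ≥ 10⁵` with `RH(T)`, for `4ᵏ ≤ P ≤ 4ᵏ⁺¹`, `P ≤ Y ≤ 10¹⁹`, `Q ≤ P`, the level
condition `0.0463 + (1 + 2/L1 k)·tailH(T)·(√Y + 1/√Y)/2 ≤ b″_k` gives the CA Mertens inequality (reflected point bound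
`negLog_le_Eb_point_refl` + `key_ineq_levelH` + `mertens_prod_lt_of`; Büthe 2018 and BKLNW are the only prints). -/
theorem mertensProdLt_levelH (hB : Buthe2018_thm2_theta) (hK : BroadbentEtAl2021_theta_rel_1e19)
    {T : ℝ} (hT : 100000 ≤ T) (hRH : RiemannHypothesisUpTo T) {k : ℕ} (hk18 : 18 ≤ k) (hk31 : k ≤ 31) {Y : ℝ}
    (hY19 : Y ≤ (10 : ℝ) ^ 19)
    (hlev : 0.0463 + (1 + 2 / ((L1 k : ℚ) : ℝ)) *
      (((Real.log (T / (2 * π)) + 1) / (π * T) + (184 + 30 * Real.log T) / T ^ 2) * ((√Y + (√Y)⁻¹) / 2)) ≤ ((bkH k : ℚ) : ℝ))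
    {P Q : ℕ} (hPl : 4 ^ k ≤ P) (hPu : P ≤ 4 ^ (k + 1)) (hPY : (P : ℝ) ≤ Y) (hQP : Q ≤ P) :
    (∏ p ∈ Nat.primesLE P, (1 - (p : ℝ)⁻¹))⁻¹ *
        ∏ p ∈ (Nat.primesLE P).filter (fun p => Q < p), (1 - ((p : ℝ) ^ 2)⁻¹) <
      rexp eulerMascheroniConstant * Real.log (θ P + θ Q) := by
  have hT7 : (7 : ℝ) ≤ T := by linarith
  have ht0 := Summit.RiemannHypothesis.RiemannHypothesis.Theorems.Splittings.RobinFiniteTail.tailH_nonneg hT7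
  obtain ⟨hP₁599, hL₁, -, -, hL₁8, -, -⟩ := range_facts (k := k) (by omega)
  have hPr : (4 : ℝ) ^ k ≤ P := by exact_mod_cast hPl
  have hP599 : (599 : ℝ) ≤ P := hP₁599.trans hPr
  have hP11 : 4 ^ 11 ≤ P := le_trans (Nat.pow_le_pow_right (by norm_num) (by omega : 11 ≤ k)) hPl
  have hPB : (P : ℝ) ≤ (10 : ℝ) ^ 19 := hPY.trans hY19
  have hL₁0 : (0 : ℝ) < ((L1 k : ℚ) : ℝ) := by linarith
  have hW := thetaWindow_ofB hB
  have hlow := negLog_le_Eb_point_refl hB hK hT7 hRH hW hP599 hPB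
  have hlogP : ((L1 k : ℚ) : ℝ) ≤ Real.log P := hL₁.trans (Real.log_le_log (by positivity) hPr)
  have h2 : 2 / Real.log (P : ℝ) ≤ 2 / ((L1 k : ℚ) : ℝ) := div_le_div_of_nonneg_left (by norm_num) hL₁0 hlogP
  have h2' : (0 : ℝ) ≤ 2 / Real.log (P : ℝ) := div_nonneg (by norm_num) (hL₁0.le.trans hlogP)
  have hsP1 : 1 ≤ √(P : ℝ) := by rw [← Real.sqrt_one]; exact Real.sqrt_le_sqrt (by linarith)
  have hsP : √(P : ℝ) ≤ √Y := Real.sqrt_le_sqrt hPY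
  have hch : (√(P : ℝ) + (√(P : ℝ))⁻¹) / 2 ≤ ((√Y + (√Y)⁻¹) / 2) := by
    have := add_inv_mono_hi hsP1 hsP; linarith
  have hch0 : 0 ≤ (√(P : ℝ) + (√(P : ℝ))⁻¹) / 2 := by positivity
  set t : ℝ := ((Real.log (T / (2 * π)) + 1) / (π * T) + (184 + 30 * Real.log T) / T ^ 2) with ht_def
  have h3 : t * ((√(P : ℝ) + (√(P : ℝ))⁻¹) / 2) ≤ t * ((√Y + (√Y)⁻¹) / 2) := mul_le_mul_of_nonneg_left hch ht0
  have h4 : (1 + 2 / Real.log (P : ℝ)) * (t * ((√(P : ℝ) + (√(P : ℝ))⁻¹) / 2)) ≤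
      (1 + 2 / ((L1 k : ℚ) : ℝ)) * (t * ((√Y + (√Y)⁻¹) / 2)) :=
    mul_le_mul (by linarith) h3 (mul_nonneg ht0 hch0) (by linarith)
  have hbud : 0.0463 + (1 + 2 / Real.log (P : ℝ)) * (t * ((√(P : ℝ) + (√(P : ℝ))⁻¹) / 2)) ≤ ((bkH k : ℚ) : ℝ) := by
    linarith
  have hkey := key_ineq_levelH hB hk18 hk31 hPl hPu hPB hQP hbud
  exact mertens_prod_lt_of hW hP11 hPB hlow hkey

/-- **CA Mertens on `4¹⁸ ≤ P ≤ X ≤ 10¹⁹`** (levels `18 … 31`, top level partial): provided every level `4ᵏ ≤ X` (`18 ≤ k ≤ 31`) passes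
`0.0463 + (1 + 2/L1 k)·tailH(T)·(√m + 1/√m)/2 ≤ b″_k`, `m = min X 4ᵏ⁺¹`. -/
theorem mertensProdLt_highH (hB : Buthe2018_thm2_theta) (hK : BroadbentEtAl2021_theta_rel_1e19)
    {T : ℝ} (hT : 100000 ≤ T) (hRH : RiemannHypothesisUpTo T) {X : ℝ} (hX19 : X ≤ (10 : ℝ) ^ 19)
    (hcell : ∀ k : ℕ, 18 ≤ k → k ≤ 31 → (4 : ℝ) ^ k ≤ X → 0.0463 + (1 + 2 / ((L1 k : ℚ) : ℝ)) *
      (((Real.log (T / (2 * π)) + 1) / (π * T) + (184 + 30 * Real.log T) / T ^ 2) * ((√(min X ((4 : ℝ) ^ (k + 1))) + (√(min X ((4 : ℝ) ^ (k + 1))))⁻¹) / 2)) ≤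
        ((bkH k : ℚ) : ℝ))
    {P Q : ℕ} (hP : 4 ^ 18 ≤ P) (hPX : (P : ℝ) ≤ X) (hQP : Q ≤ P) :
    (∏ p ∈ Nat.primesLE P, (1 - (p : ℝ)⁻¹))⁻¹ *
        ∏ p ∈ (Nat.primesLE P).filter (fun p => Q < p), (1 - ((p : ℝ) ^ 2)⁻¹) <
      rexp eulerMascheroniConstant * Real.log (θ P + θ Q) := by
  have hP0 : P ≠ 0 := by intro h; rw [h] at hP; norm_num at hP
  have hP19 : (P : ℝ) ≤ (10 : ℝ) ^ 19 := hPX.trans hX19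
  have hP32 : P < 4 ^ 32 := by
    have : (P : ℝ) < (4 : ℝ) ^ 32 := lt_of_le_of_lt hP19 (by norm_num)
    exact_mod_cast this
  have hPl : 4 ^ Nat.log 4 P ≤ P := Nat.pow_log_le_self 4 hP0
  have hPu : P < 4 ^ (Nat.log 4 P + 1) := Nat.lt_pow_succ_log_self (by norm_num) P
  have hk18 : 18 ≤ Nat.log 4 P := by
    by_contra h; rw [not_le] at h
    have : 4 ^ (Nat.log 4 P + 1) ≤ 4 ^ 18 := Nat.pow_le_pow_right (by norm_num) (by omega)
    omega
  have hk31 : Nat.log 4 P ≤ 31 := by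
    by_contra h; rw [not_le] at h
    have : 4 ^ 32 ≤ 4 ^ Nat.log 4 P := Nat.pow_le_pow_right (by norm_num) (by omega)
    omega
  have hkX : (4 : ℝ) ^ Nat.log 4 P ≤ X := le_trans (by exact_mod_cast hPl) hPX
  have hPY : (P : ℝ) ≤ min X ((4 : ℝ) ^ (Nat.log 4 P + 1)) := le_min hPX (by exact_mod_cast hPu.le)
  have hY19 : min X ((4 : ℝ) ^ (Nat.log 4 P + 1)) ≤ (10 : ℝ) ^ 19 := (min_le_left _ _).trans hX19
  exact mertensProdLt_levelH hB hK hT hRH hk18 hk31 hY19 (hcell _ hk18 hk31 hkX) hPl hPu.le hPY hQP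

open scoped ArithmeticFunction.sigma in
/-- **THE HIGH CA-SIDE HEIGHT LAW.  RH verified to a height `T ≥ 10⁵` + {Büthe 2018 Thm 2, BKLNW 2021} + Robin at the CA numbers with
primes `< 4¹⁸` ⟹ Robin's inequality at every colossally abundant `N > 5040` all of whose primes are `≤ X`**, for every natural
`X ≤ 10¹⁹` passing the high level conditions of the levels `4ᵏ ≤ X`, `18 ≤ k ≤ 31` (top level partial).  `RH(T)` in hypothesis position;
the base `robinCA_below (4 ^ 18)` is a hypothesis (discharged in the rows by the tree's `robinCA_below_of_rh1320000SR`). -/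
theorem robinCA_below_highH (hB : Buthe2018_thm2_theta) (hK : BroadbentEtAl2021_theta_rel_1e19)
    {T : ℝ} (hT : 100000 ≤ T) (hRH : RiemannHypothesisUpTo T) {X : ℕ} (hX19 : (X : ℝ) ≤ (10 : ℝ) ^ 19)
    (hbase : robinCA_below (4 ^ 18))
    (hcell : ∀ k : ℕ, 18 ≤ k → k ≤ 31 → (4 : ℝ) ^ k ≤ (X : ℝ) → 0.0463 + (1 + 2 / ((L1 k : ℚ) : ℝ)) *
      (((Real.log (T / (2 * π)) + 1) / (π * T) + (184 + 30 * Real.log T) / T ^ 2) * ((√(min (X : ℝ) ((4 : ℝ) ^ (k + 1))) + (√(min (X : ℝ) ((4 : ℝ) ^ (k + 1))))⁻¹) / 2)) ≤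
        ((bkH k : ℚ) : ℝ)) :
    robinCA_below (X + 1) := by
  intro N hCA h5040 hprimes
  obtain ⟨ε, P, Q, -, -, hP, hPN, -, hQP, hpf, -, -, hσ, hθ, -⟩ := hCA.exists_structure
  by_cases hsmall : P < 4 ^ 18
  · refine hbase N hCA h5040 fun p hp hpN => lt_of_le_of_lt ?_ hsmall
    have hN0 : N ≠ 0 := by omega
    have : p ∈ N.primeFactors := Nat.mem_primeFactors.2 ⟨hp, hpN, hN0⟩
    rw [hpf] at this
    exact (Nat.mem_primesLE.1 this).1
  · rw [not_lt] at hsmall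
    have hPX : (P : ℝ) ≤ X := by
      have := hprimes P hP hPN
      exact_mod_cast Nat.lt_succ_iff.1 this
    have hlt := mertensProdLt_highH hB hK hT hRH hX19 hcell hsmall hPX hQP
    have hN0 : N ≠ 0 := by omega
    have hNpos : (0 : ℝ) < N := by exact_mod_cast Nat.pos_of_ne_zero hN0
    have hθpos : 0 < θ P + θ Q := by
      have h1 : 0 < θ (P : ℝ) := Chebyshev.theta_pos (by exact_mod_cast hP.two_le)
      have h2 : 0 ≤ θ (Q : ℝ) := Chebyshev.theta_nonneg _
      linarith
    have hlog : Real.log (θ P + θ Q) ≤ Real.log (Real.log N) := Real.log_le_log hθpos hθ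
    have hlt' : (σ 1 N : ℝ) / N < rexp eulerMascheroniConstant * Real.log (Real.log N) :=
      lt_of_le_of_lt hσ (hlt.trans_le (mul_le_mul_of_nonneg_left hlog (Real.exp_pos _).le))
    unfold robinInequality
    rw [div_lt_iff₀ hNpos] at hlt'
    linarith

/-- High per-level tail tolerances `2(b″_k − 0.0463)/((1 + 2/L1 k)(2ᵏ⁺¹ + 2⁻ᵏ⁻¹))` rounded down (`k = 18 … 31`).  A FULL level `k`
passes as soon as `tailH(T) ≤ tolHi k`. -/
def tolHi : ℕ → ℚ
  | 18 => 19837 / 10 ^ 10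
  | 19 => 10294 / 10 ^ 10
  | 20 => 53343 / 10 ^ 11
  | 21 => 27203 / 10 ^ 11
  | 22 => 13843 / 10 ^ 11
  | 23 => 70635 / 10 ^ 12
  | 24 => 35742 / 10 ^ 12
  | 25 => 18080 / 10 ^ 12
  | 26 => 91158 / 10 ^ 13
  | 27 => 46021 / 10 ^ 13
  | 28 => 23194 / 10 ^ 13
  | 29 => 11670 / 10 ^ 13
  | 30 => 58709 / 10 ^ 14
  | 31 => 29487 / 10 ^ 14
  | _ => 0

/-- The (full) high level condition from the tolerance (`4ᵏ ≤ X`, so that `1 ≤ √m ≤ 2ᵏ⁺¹`). -/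
theorem levelH_of_tol {t X : ℝ} {k : ℕ} (hk18 : 18 ≤ k) (hk31 : k ≤ 31) (hX : (4 : ℝ) ^ k ≤ X) (ht0 : 0 ≤ t)
    (ht : t ≤ ((tolHi k : ℚ) : ℝ)) :
    0.0463 + (1 + 2 / ((L1 k : ℚ) : ℝ)) * (t * ((√(min X ((4 : ℝ) ^ (k + 1))) + (√(min X ((4 : ℝ) ^ (k + 1))))⁻¹) / 2)) ≤ ((bkH k : ℚ) : ℝ) := by
  have hL₁8 := (range_facts (k := k) (by omega)).2.2.2.2.1
  have hm1 : (1 : ℝ) ≤ min X ((4 : ℝ) ^ (k + 1)) :=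
    le_min ((one_le_pow₀ (by norm_num : (1 : ℝ) ≤ 4)).trans hX) (one_le_pow₀ (by norm_num))
  have hs1 : 1 ≤ √(min X ((4 : ℝ) ^ (k + 1))) := by rw [← Real.sqrt_one]; exact Real.sqrt_le_sqrt hm1
  have hs : √(min X ((4 : ℝ) ^ (k + 1))) ≤ 2 ^ (k + 1) := by
    rw [← sqrt_four_pow]; exact Real.sqrt_le_sqrt (min_le_right _ _)
  have hch : ((√(min X ((4 : ℝ) ^ (k + 1))) + (√(min X ((4 : ℝ) ^ (k + 1))))⁻¹) / 2) ≤ ((2 : ℝ) ^ (k + 1) + ((2 : ℝ) ^ (k + 1))⁻¹) / 2 := by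
    have := add_inv_mono_hi hs1 hs; linarith
  have hfac0 : (0 : ℝ) ≤ 1 + 2 / ((L1 k : ℚ) : ℝ) := by
    have : (0 : ℝ) ≤ 2 / ((L1 k : ℚ) : ℝ) := div_nonneg (by norm_num) (by linarith)
    linarith
  have h1 : (1 + 2 / ((L1 k : ℚ) : ℝ)) * (t * ((√(min X ((4 : ℝ) ^ (k + 1))) + (√(min X ((4 : ℝ) ^ (k + 1))))⁻¹) / 2)) ≤
      (1 + 2 / ((L1 k : ℚ) : ℝ)) * (t * (((2 : ℝ) ^ (k + 1) + ((2 : ℝ) ^ (k + 1))⁻¹) / 2)) :=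
    mul_le_mul_of_nonneg_left (mul_le_mul_of_nonneg_left hch ht0) hfac0
  have h2 : 0.0463 + (1 + 2 / ((L1 k : ℚ) : ℝ)) * (t * (((2 : ℝ) ^ (k + 1) + ((2 : ℝ) ^ (k + 1))⁻¹) / 2)) ≤ ((bkH k : ℚ) : ℝ) := by
    interval_cases k <;>
      · simp only [tolHi, bkH, L1, l2] at ht ⊢; push_cast at ht ⊢; norm_num at ht ⊢; nlinarith [ht]
  linarith

/-- **Full high levels at height `T`**: if `T ≥ 1.32·10⁶` (so that the tree's `robinCA_below_of_rh1320000SR` gives the base `4¹⁸`), and every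
level `18 ≤ k ≤ K` (`K ≤ 30`) has `tailH(T) ≤ tolHi k`, then Robin holds at every CA number `> 5040` with primes `< 4^{K+1}`. -/
theorem robinCA_below_cellsH (hB : Buthe2018_thm2_theta) (hK : BroadbentEtAl2021_theta_rel_1e19)
    {T : ℝ} (hT : 1320000 ≤ T) (hRH : RiemannHypothesisUpTo T) {K : ℕ} (hK18 : 18 ≤ K) (hK30 : K ≤ 30)
    (htol : ∀ k : ℕ, 18 ≤ k → k ≤ K → ((Real.log (T / (2 * π)) + 1) / (π * T) + (184 + 30 * Real.log T) / T ^ 2) ≤ ((tolHi k : ℚ) : ℝ)) :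
    robinCA_below (4 ^ (K + 1)) := by
  have hT5 : (100000 : ℝ) ≤ T := le_trans (by norm_num) hT
  have hT7 : (7 : ℝ) ≤ T := by linarith
  have ht0 := Summit.RiemannHypothesis.RiemannHypothesis.Theorems.Splittings.RobinFiniteTail.tailH_nonneg hT7
  have hbase := robinCA_below_of_rh1320000SR hB hK hT hRH
  have h1 : 1 ≤ 4 ^ (K + 1) := Nat.one_le_pow _ _ (by norm_num)
  rw [← Nat.sub_add_cancel h1]
  set X : ℕ := 4 ^ (K + 1) - 1 with hX_def
  have hXr : (X : ℝ) = (4 : ℝ) ^ (K + 1) - 1 := by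
    rw [hX_def, Nat.cast_sub h1]; push_cast; ring
  have hX19 : (X : ℝ) ≤ (10 : ℝ) ^ 19 := by
    rw [hXr]; have : (4 : ℝ) ^ (K + 1) ≤ 4 ^ 31 := pow_le_pow_right₀ (by norm_num) (by omega); linarith [show ((4 : ℝ) ^ 31) ≤ (10 : ℝ) ^ 19 by norm_num]
  refine robinCA_below_highH hB hK hT5 hRH (X := X) hX19 hbase ?_
  intro k hk18 hk31 hkX
  have hkK : k ≤ K := by
    by_contra h
    rw [not_le] at h
    have : (4 : ℝ) ^ (K + 1) ≤ 4 ^ k := pow_le_pow_right₀ (by norm_num) (by omega)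
    rw [hXr] at hkX; linarith
  exact levelH_of_tol hk18 hk31 hkX ht0 (htol k hk18 hkK)

end HighLaw

end Summit.RiemannHypothesis.RiemannHypothesis.Theorems.Splittings.RobinFiniteC1

end
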